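import Summits.ValiantsHypothesis.ValiantsHypothesis.Theorems.GrenetZeonDualUnipotentThreeHalvesHeavyTopKrylovSeedDefs

/-!
# `GrenetZeon.DualUnipotentThreeHalves` (stmt-ValiantsHypothesis-24318), LINE α `krylov_seed`, calibration of the research stub S1b
# `stub_fatBlockWeightLaw`: THE MONOLITH PENCILS W₆ AT (4,6), W₇ AT (4,7) AND W₉ AT (5,9) ARE WEIGHT-THIN — kernel rows of the census certificates
# (val-htc-lead g0 `W29-CERT.md` v0.1: W₆ levels (2,2,1,1,0,0), W₉ levels (2,2,2,1,1,1,0,0,0), both `p = 3`, `r = 1`, `c = 1`;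
# `dim K = 14 > 12`, resp. `21 > 20`)

Lead prover val-port-2 g2.  val-idea-29's monolith `W₆ = MOR₂ + ⟨E₄₃, E₄₅, E₂₅⟩ ⊂ M₆(ℂ)` (8-dimensional; the cell certifies exactly —
NOT in the kernel here — that it is a NILPOTENT space of full index 6 and IRREDUCIBLE, whence `ι(6) ≥ 8`) spans the tops of the affine
pencil `NW6` below (one coordinate of `ℂ^{4×4}` per generator — `(0,0),(0,1),(0,2),(0,3),(1,0),(1,1),(1,2),(1,3)` — constant part `0`).  Its nilpotent space `W = W₆` has NO invariant flag at
all, so `NW6` lies in the FAT-IRREDUCIBLE-FACTOR locus of S1b (`¬ SmallBlockStructure 4 6 NW6 2`, granted irreducibility); the theorem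
★ `weightThin_NW6 : WeightThin 4 6 NW6` is the census's (T)-certificate made kernel: identity change of basis, `lvl = (2,2,1,1,0,0)`, drop
`r = 1` (the generator `E₃₁+E₄₂−E₅₃−E₆₄` descends one level), climb `c = 1` on `K = {v : v kills the two non-climbing generators
E₃₁+E₄₂−E₅₃−E₆₄ and E₄₃}` (`dim K = 14`), budget `((p−1+r(n−1))/(c+r)+1)·n = 12 < 14`.  Likewise ★ `weightThin_NW9 : WeightThin 5 9 NW9` for val-idea-29's `W₉ = MOR₃ + 9 generators ⊂ M₉(ℂ)`
(19-dimensional, full index 9, irreducible — `ι(9) ≥ 19`, cell-certified): `lvl = (2,2,2,1,1,1,0,0,0)`, `K` kills the four non-climbing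
generators (coordinates `(3,0),(3,1),(3,2),(3,3)`), `dim K = 21 > 20 = ((2+4)/2+1)·5`.

Also ★ `weightThin_NW7 : WeightThin 4 7 NW7` (W₇, 12 generators; T-full certificate `lvl = (1,2,0,2,0,1,0)`, `p = 3`, `r = 1`, `c = 2`,
`dim K = 10 > 8`) — at the format (4,7) where R2's instance FAILS on `NSeven` (✓ p648631), the monolith is weight-thin.

Honest framing.  THREE calibration instances of the open research stub S1b (`--supports stmt-ValiantsHypothesis-24318 --as helper`): S1b
predicts weight-thinness on this locus and all three comply.  Nilpotency / irreducibility of `W₆`, `W₇`, `W₉` are the cell's exact certificates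
(W29-CERT P0), not proved here and not needed for `WeightThin`.  Nothing here proves S1b, C⁺, R2 `HeavyTopLaw`, the crux, 8062 or
`VP ≠ VNP` — all OPEN / NOT proved. [val-idea-29 data via val-idea-26 `check_W29.py`; val-htc-lead `W29-CERT.md`]
-/

set_option linter.dupNamespace false
set_option autoImplicit false

noncomputable section

namespace Summit.ValiantsHypothesis.ValiantsHypothesis.Theorems.GrenetZeon.KrylovSeed

open MvPolynomial Matrix
open scoped BigOperators
open Summit.ValiantsHypothesis.ValiantsHypothesis.Cruxes.TwoDimCoefficients.DimTwoCases (AffMat IsAffine)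
open Summit.ValiantsHypothesis.ValiantsHypothesis.Theorems.GrenetZeon.RadicalSplit (linPart)

/-- **The monolith pencil `NW6`** (0-based entries): tops `X₀₀(E₀₂+E₂₄) + X₀₁(E₀₃+E₂₅) + X₀₂(E₁₂+E₃₄) + X₀₃(E₁₃+E₃₅) +
X₁₀(E₂₀+E₃₁−E₄₂−E₅₃) + X₁₁E₃₂ + X₁₂E₃₄ + X₁₃E₁₄` = val-idea-29's `W₆ = MOR₂ + ⟨E₄₃,E₄₅,E₂₅⟩` (1-based names), constant part `0`. -/
def NW6 : AffMat 4 6 :=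
  !![0, 0, X (0, 0), X (0, 1), 0, 0;
     0, 0, X (0, 2), X (0, 3), X (1, 3), 0;
     X (1, 0), 0, 0, 0, X (0, 0), X (0, 1);
     0, X (1, 0), X (1, 1), 0, X (0, 2) + X (1, 2), X (0, 3);
     0, 0, -X (1, 0), 0, 0, 0;
     0, 0, 0, -X (1, 0), 0, 0]

/-- `NW6` is affine (entries of total degree `≤ 1`). -/
theorem isAffine_NW6 : IsAffine NW6 := by
  have hadd : ((X (0, 2) + X (1, 2) : MvPolynomial (Fin 4 × Fin 4) ℂ)).totalDegree ≤ 1 :=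
    (totalDegree_add _ _).trans (by rw [totalDegree_X, totalDegree_X]; simp)
  intro i j
  fin_cases i <;> fin_cases j <;> simp [NW6, totalDegree_X, totalDegree_neg, hadd]

/-- The level function `(2,2,1,1,0,0)` of the census certificate. -/
def lvlW6 : Fin 6 → ℕ := ![2, 2, 1, 1, 0, 0]

/-- ★ **W₆@(4,6) IS WEIGHT-THIN**: `WeightThin 4 6 NW6` with `P = 1`, `lvl = (2,2,1,1,0,0)`, `p = 3`, `r = 1`, `c = 1`,
`K = {v : v (1,0) = 0 ∧ v (1,1) = 0}` (`dim K = 14 > 12`). [census W29-CERT v0.1, kernel form; this file] -/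
theorem weightThin_NW6 : WeightThin 4 6 NW6 := by
  classical
  -- the direction space: kill the two non-climbing generators
  let f : (Fin 4 × Fin 4 → ℂ) →ₗ[ℂ] (Fin 2 → ℂ) :=
    LinearMap.pi fun t => LinearMap.proj (if t = 0 then ((1 : Fin 4), (0 : Fin 4)) else ((1 : Fin 4), (1 : Fin 4)))
  have hker : ∀ v ∈ LinearMap.ker f, v (1, 0) = 0 ∧ v (1, 1) = 0 := by
    intro v hv
    rw [LinearMap.mem_ker] at hv
    have h0 := congr_fun hv 0
    have h1 := congr_fun hv 1
    simp only [f, LinearMap.pi_apply, LinearMap.coe_proj, Function.eval, Pi.zero_apply] at h0 h1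
    exact ⟨by simpa using h0, by simpa using h1⟩
  have hdim : 12 < Module.finrank ℂ (LinearMap.ker f) := by
    have h1 := LinearMap.finrank_range_add_finrank_ker f
    have h2 : Module.finrank ℂ (LinearMap.range f) ≤ 2 := by
      have := Submodule.finrank_le (LinearMap.range f)
      simpa using this
    have h3 : Module.finrank ℂ (Fin 4 × Fin 4 → ℂ) = 16 := by simp
    omega
  refine ⟨1, lvlW6, 3, 1, 1, LinearMap.ker f, le_rfl, ?_, ?_, ?_, ?_⟩
  · intro i; fin_cases i <;> simp [lvlW6]
  · -- drop r = 1: entries two or more levels up vanish identically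
    intro i j hij
    have hC : ((1 : (Matrix (Fin 6) (Fin 6) ℂ)ˣ) : Matrix (Fin 6) (Fin 6) ℂ).map
        (C : ℂ → MvPolynomial (Fin 4 × Fin 4) ℂ) = 1 := by
      rw [Units.val_one, Matrix.map_one C C_0 C_1]
    have hC' : ((1⁻¹ : (Matrix (Fin 6) (Fin 6) ℂ)ˣ) : Matrix (Fin 6) (Fin 6) ℂ).map
        (C : ℂ → MvPolynomial (Fin 4 × Fin 4) ℂ) = 1 := by
      rw [inv_one, Units.val_one, Matrix.map_one C C_0 C_1]
    rw [hC, hC', Matrix.one_mul, Matrix.mul_one]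
    fin_cases i <;> fin_cases j <;> simp [lvlW6] at hij <;> simp [NW6]
  · -- climb c = 1 on K
    intro v hv i j hij
    obtain ⟨h4, h5⟩ := hker v hv
    rw [Units.val_one, inv_one, Units.val_one, Matrix.one_mul, Matrix.mul_one]
    simp only [linPart, Matrix.sub_apply, Matrix.map_apply]
    fin_cases i <;> fin_cases j <;> simp [lvlW6] at hij <;> simp [NW6, h4, h5]
  · -- budget ((3-1+1*3)/(1+1)+1)*4 = 12 < 14
    simpa using hdim


/-! ## W₉ at format (5,9) -/

/-- **The monolith pencil `NW9`** (0-based entries) — val-idea-29's `W₉ = MOR₃ + ⟨E₂₆+E₄₆, E₄₅−E₅₆, E₁₆+E₅₆, E₁₅−E₁₆, E₄₈+E₄₉, E₁₉−E₅₉,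
E₁₈+E₄₈, E₁₅−E₁₉, E₂₉+E₅₉⟩` (1-based names), `MOR₃ = ⟨E_{a,3+c}+E_{3+a,6+c} (a,c ≤ 3), Σ_a E_{3+a,a} − Σ_a E_{6+a,3+a}⟩`; one coordinate of
`ℂ^{5×5}` per generator: `(a−1,c−1)` for MOR₃'s nine, `(3,0)` for its tenth, `(3,1),(3,2),(3,3)` for the three further NON-climbing
generators `E₂₆+E₄₆, E₄₅−E₅₆, E₁₆+E₅₆`, and `(3,4),(4,0),…,(4,4)` for the five climbing ones; constant part `0`. -/
def NW9 : AffMat 5 9 :=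
  !![0, 0, 0, X (0, 0), X (0, 1) + X (3, 4) + X (4, 3), X (0, 2) + X (3, 3) - X (3, 4), 0, X (4, 2), X (4, 1) - X (4, 3);
     0, 0, 0, X (1, 0), X (1, 1), X (1, 2) + X (3, 1), 0, 0, X (4, 4);
     0, 0, 0, X (2, 0), X (2, 1), X (2, 2), 0, 0, 0;
     X (3, 0), 0, 0, 0, X (3, 2), X (3, 1), X (0, 0), X (0, 1) + X (4, 0) + X (4, 2), X (0, 2) + X (4, 0);
     0, X (3, 0), 0, 0, 0, -X (3, 2) + X (3, 3), X (1, 0), X (1, 1), X (1, 2) - X (4, 1) + X (4, 4);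
     0, 0, X (3, 0), 0, 0, 0, X (2, 0), X (2, 1), X (2, 2);
     0, 0, 0, -X (3, 0), 0, 0, 0, 0, 0;
     0, 0, 0, 0, -X (3, 0), 0, 0, 0, 0;
     0, 0, 0, 0, 0, -X (3, 0), 0, 0, 0]

/-- The level function `(2,2,2,1,1,1,0,0,0)` of the census certificate for `W₉`. -/
def lvlW9 : Fin 9 → ℕ := ![2, 2, 2, 1, 1, 1, 0, 0, 0]

set_option maxHeartbeats 800000 in
/-- ★ **W₉@(5,9) IS WEIGHT-THIN**: `WeightThin 5 9 NW9` with `P = 1`, `lvl = (2,2,2,1,1,1,0,0,0)`, `p = 3`, `r = 1`, `c = 1`,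
`K = {v : v (3,0) = v (3,1) = v (3,2) = v (3,3) = 0}` (`dim K = 21 > 20`). [census W29-CERT v0.1, kernel form; this file] -/
theorem weightThin_NW9 : WeightThin 5 9 NW9 := by
  classical
  let f : (Fin 5 × Fin 5 → ℂ) →ₗ[ℂ] (Fin 4 → ℂ) :=
    LinearMap.pi fun t => LinearMap.proj (((3 : Fin 5)), (⟨t.val, by omega⟩ : Fin 5))
  have hker : ∀ v ∈ LinearMap.ker f, v (3, 0) = 0 ∧ v (3, 1) = 0 ∧ v (3, 2) = 0 ∧ v (3, 3) = 0 := by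
    intro v hv
    rw [LinearMap.mem_ker] at hv
    have h0 := congr_fun hv 0
    have h1 := congr_fun hv 1
    have h2 := congr_fun hv 2
    have h3 := congr_fun hv 3
    simp only [f, LinearMap.pi_apply, LinearMap.coe_proj, Function.eval, Pi.zero_apply] at h0 h1 h2 h3
    exact ⟨h0, h1, h2, h3⟩
  have hdim : 20 < Module.finrank ℂ (LinearMap.ker f) := by
    have h1 := LinearMap.finrank_range_add_finrank_ker f
    have h2 : Module.finrank ℂ (LinearMap.range f) ≤ 4 := by
      have := Submodule.finrank_le (LinearMap.range f)
      simpa using this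
    have h3 : Module.finrank ℂ (Fin 5 × Fin 5 → ℂ) = 25 := by simp
    omega
  refine ⟨1, lvlW9, 3, 1, 1, LinearMap.ker f, le_rfl, ?_, ?_, ?_, ?_⟩
  · intro i; fin_cases i <;> simp [lvlW9]
  · intro i j hij
    have hC : ((1 : (Matrix (Fin 9) (Fin 9) ℂ)ˣ) : Matrix (Fin 9) (Fin 9) ℂ).map
        (C : ℂ → MvPolynomial (Fin 5 × Fin 5) ℂ) = 1 := by
      rw [Units.val_one, Matrix.map_one C C_0 C_1]
    have hC' : ((1⁻¹ : (Matrix (Fin 9) (Fin 9) ℂ)ˣ) : Matrix (Fin 9) (Fin 9) ℂ).map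
        (C : ℂ → MvPolynomial (Fin 5 × Fin 5) ℂ) = 1 := by
      rw [inv_one, Units.val_one, Matrix.map_one C C_0 C_1]
    rw [hC, hC', Matrix.one_mul, Matrix.mul_one]
    fin_cases i <;> fin_cases j <;> simp [lvlW9] at hij <;> simp [NW9]
  · intro v hv i j hij
    obtain ⟨h0, h1, h2, h3⟩ := hker v hv
    rw [Units.val_one, inv_one, Units.val_one, Matrix.one_mul, Matrix.mul_one]
    simp only [linPart, Matrix.sub_apply, Matrix.map_apply]
    fin_cases i <;> fin_cases j <;> simp [lvlW9] at hij <;> simp [NW9, h0, h1, h2, h3]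
  · simpa using hdim

/-- `NW9` is affine (entries of total degree `≤ 1`). -/
theorem isAffine_NW9 : IsAffine NW9 := by
  have h1 : ∀ a b : Fin 5 × Fin 5, ((X a + X b : MvPolynomial (Fin 5 × Fin 5) ℂ)).totalDegree ≤ 1 := fun a b =>
    (totalDegree_add _ _).trans (by rw [totalDegree_X, totalDegree_X]; simp)
  have h2 : ∀ a b : Fin 5 × Fin 5, ((X a - X b : MvPolynomial (Fin 5 × Fin 5) ℂ)).totalDegree ≤ 1 := fun a b =>
    (totalDegree_sub _ _).trans (by rw [totalDegree_X, totalDegree_X]; simp)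
  have h3 : ∀ a b c : Fin 5 × Fin 5, ((X a + X b + X c : MvPolynomial (Fin 5 × Fin 5) ℂ)).totalDegree ≤ 1 :=
    fun a b c => (totalDegree_add _ _).trans (max_le (h1 a b) (by rw [totalDegree_X]))
  have h4 : ∀ a b c : Fin 5 × Fin 5, ((X a + X b - X c : MvPolynomial (Fin 5 × Fin 5) ℂ)).totalDegree ≤ 1 :=
    fun a b c => (totalDegree_sub _ _).trans (max_le (h1 a b) (by rw [totalDegree_X]))
  have h5 : ∀ a b c : Fin 5 × Fin 5, ((X a - X b + X c : MvPolynomial (Fin 5 × Fin 5) ℂ)).totalDegree ≤ 1 :=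
    fun a b c => (totalDegree_add _ _).trans (max_le (h2 a b) (by rw [totalDegree_X]))
  have h6 : ∀ a b : Fin 5 × Fin 5, ((-X a + X b : MvPolynomial (Fin 5 × Fin 5) ℂ)).totalDegree ≤ 1 := fun a b =>
    (totalDegree_add _ _).trans (max_le (by rw [totalDegree_neg, totalDegree_X]) (by rw [totalDegree_X]))
  intro i j
  fin_cases i <;> fin_cases j <;> simp [NW9, totalDegree_X, totalDegree_neg, h1, h2, h3, h4, h5, h6]

/-! ## W₇ at format (4,7) — the format where R2's instance FAILS (✓ p648631 `not_heavyTopInst_four_seven`, witness `NSeven`) -/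

/-- **The monolith pencil `NW7`** (0-based entries) — val-idea-29's `W₇ = MOR₂ + ⟨E₂₃+E₂₇, E₄₅−E₇₅, E₇₃+E₇₅, E₄₅+E₄₇, E₂₅+E₄₇, E₂₃−E₄₃,
E₂₇⟩ ⊂ M₇(ℂ)` (1-based names; 12 generators on the coordinates `(0,0..3)` = MOR₂'s `E₁₃+E₃₅, E₁₄+E₃₆, E₂₃+E₄₅, E₂₄+E₄₆`, `(1,0)` =
`E₃₁+E₄₂−E₅₃−E₆₄`, `(1,1..3), (2,0..3)` = the seven others in the listed order); constant part `0`. -/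
def NW7 : AffMat 4 7 :=
  !![0, 0, X (0, 0), X (0, 1), 0, 0, 0;
     0, 0, X (0, 2) + X (1, 1) + X (2, 2), X (0, 3), X (2, 1), 0, X (1, 1) + X (2, 3);
     X (1, 0), 0, 0, 0, X (0, 0), X (0, 1), 0;
     0, X (1, 0), -X (2, 2), 0, X (0, 2) + X (1, 2) + X (2, 0), X (0, 3), X (2, 0) + X (2, 1);
     0, 0, -X (1, 0), 0, 0, 0, 0;
     0, 0, 0, -X (1, 0), 0, 0, 0;
     0, 0, X (1, 3), 0, -X (1, 2) + X (1, 3), 0, 0]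

/-- The level function `(1,2,0,2,0,1,0)` of the census's T-full certificate for `W₇` (W29-CERT v0.2). -/
def lvlW7 : Fin 7 → ℕ := ![1, 2, 0, 2, 0, 1, 0]

set_option maxHeartbeats 800000 in
/-- ★ **W₇@(4,7) IS WEIGHT-THIN** — at the very format where R2's instance fails on `NSeven`: `WeightThin 4 7 NW7` with `P = 1`,
`lvl = (1,2,0,2,0,1,0)`, `p = 3`, `r = 1`, CLIMB `c = 2`, `K = {v : v vanishes on the six non-climbing coordinates (0,0),(0,1),(0,3),(1,0),
(1,2),(1,3)}` (`dim K = 10 > 8 = ((2+3)/3+1)·4`).  So the monolith is NOT a second `¬ HeavyTopInst 4 7` witness (it is weight-thin, hence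
flag-cheap by ✓ `flagCheap_of_weightThin`). [census W29-CERT v0.2, kernel form; this file] -/
theorem weightThin_NW7 : WeightThin 4 7 NW7 := by
  classical
  let f : (Fin 4 × Fin 4 → ℂ) →ₗ[ℂ] (Fin 6 → ℂ) :=
    LinearMap.pi fun t => LinearMap.proj (![((0 : Fin 4), (0 : Fin 4)), (0, 1), (0, 3), (1, 0), (1, 2), (1, 3)] t)
  have hker : ∀ v ∈ LinearMap.ker f, v (0, 0) = 0 ∧ v (0, 1) = 0 ∧ v (0, 3) = 0 ∧ v (1, 0) = 0 ∧ v (1, 2) = 0 ∧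
      v (1, 3) = 0 := by
    intro v hv
    rw [LinearMap.mem_ker] at hv
    have h0 := congr_fun hv 0
    have h1 := congr_fun hv 1
    have h2 := congr_fun hv 2
    have h3 := congr_fun hv 3
    have h4 := congr_fun hv 4
    have h5 := congr_fun hv 5
    simp only [f, LinearMap.pi_apply, LinearMap.coe_proj, Function.eval, Pi.zero_apply] at h0 h1 h2 h3 h4 h5
    exact ⟨by simpa using h0, by simpa using h1, by simpa using h2, by simpa using h3, by simpa using h4,
      by simpa using h5⟩
  have hdim : 8 < Module.finrank ℂ (LinearMap.ker f) := by
    have h1 := LinearMap.finrank_range_add_finrank_ker f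
    have h2 : Module.finrank ℂ (LinearMap.range f) ≤ 6 := by
      have := Submodule.finrank_le (LinearMap.range f)
      simpa using this
    have h3 : Module.finrank ℂ (Fin 4 × Fin 4 → ℂ) = 16 := by simp
    omega
  refine ⟨1, lvlW7, 3, 1, 2, LinearMap.ker f, by norm_num, ?_, ?_, ?_, ?_⟩
  · intro i; fin_cases i <;> simp [lvlW7]
  · intro i j hij
    have hC : ((1 : (Matrix (Fin 7) (Fin 7) ℂ)ˣ) : Matrix (Fin 7) (Fin 7) ℂ).map
        (C : ℂ → MvPolynomial (Fin 4 × Fin 4) ℂ) = 1 := by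
      rw [Units.val_one, Matrix.map_one C C_0 C_1]
    have hC' : ((1⁻¹ : (Matrix (Fin 7) (Fin 7) ℂ)ˣ) : Matrix (Fin 7) (Fin 7) ℂ).map
        (C : ℂ → MvPolynomial (Fin 4 × Fin 4) ℂ) = 1 := by
      rw [inv_one, Units.val_one, Matrix.map_one C C_0 C_1]
    rw [hC, hC', Matrix.one_mul, Matrix.mul_one]
    fin_cases i <;> fin_cases j <;> simp [lvlW7] at hij <;> simp [NW7]
  · intro v hv i j hij
    obtain ⟨h0, h1, h2, h3, h4, h5⟩ := hker v hv
    rw [Units.val_one, inv_one, Units.val_one, Matrix.one_mul, Matrix.mul_one]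
    simp only [linPart, Matrix.sub_apply, Matrix.map_apply]
    fin_cases i <;> fin_cases j <;> simp [lvlW7] at hij <;> simp [NW7, h0, h1, h2, h3, h4, h5]
  · simpa using hdim

/-- `NW7` is affine (entries of total degree `≤ 1`). -/
theorem isAffine_NW7 : IsAffine NW7 := by
  have h1 : ∀ a b : Fin 4 × Fin 4, ((X a + X b : MvPolynomial (Fin 4 × Fin 4) ℂ)).totalDegree ≤ 1 := fun a b =>
    (totalDegree_add _ _).trans (by rw [totalDegree_X, totalDegree_X]; simp)
  have h3 : ∀ a b c : Fin 4 × Fin 4, ((X a + X b + X c : MvPolynomial (Fin 4 × Fin 4) ℂ)).totalDegree ≤ 1 :=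
    fun a b c => (totalDegree_add _ _).trans (max_le (h1 a b) (by rw [totalDegree_X]))
  have h6 : ∀ a b : Fin 4 × Fin 4, ((-X a + X b : MvPolynomial (Fin 4 × Fin 4) ℂ)).totalDegree ≤ 1 := fun a b =>
    (totalDegree_add _ _).trans (max_le (by rw [totalDegree_neg, totalDegree_X]) (by rw [totalDegree_X]))
  intro i j
  fin_cases i <;> fin_cases j <;> simp [NW7, totalDegree_X, totalDegree_neg, h1, h3, h6]

end Summit.ValiantsHypothesis.ValiantsHypothesis.Theorems.GrenetZeon.KrylovSeed

end
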